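import Literature.MathematicalPhysics.QuantumFieldTheory.Balaban1983to89.B6MultiLevelBoxOperator
import Literature.MathematicalPhysics.QuantumFieldTheory.Balaban1983to89.B6Ineq261LevelGap

/-!
# `Balaban1983to89.B6Geom246MultiLevelBox` — [B6] THE BLOCK GEOMETRY `𝔅`, THE DISTANCE (2.46) AND LEMMA 2.1 (2.60)–(2.63)
FOR A GENUINE NESTED FAMILY OF DOMAINS ON A BOX (file 4 of the multi-level parametrix: the geometry on which the chain
(2.64)–(2.66) of Prop. 2.2 runs for the genuine `k`-level operator of `B6MultiLevelBoxOperator`; no existing module is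
touched; no fact is minted)

FRAMING (verbatim cell line):
statement-level skeleton of published theorems with citation tags; proofs where landed; nothing here is a claim about the Yang–Mills mass gap

Source under audit (cell pub-balaban / lit-balaban): T. Bałaban, *Propagators and renormalization transformations for
lattice gauge theories. II*, Commun. Math. Phys. **96** (1984) 223–250 [`Balaban1984PropagatorsII`, "B6"], p. 224 [PDF 2]
(2.1)–(2.4), p. 231 [PDF 9] (2.45)–(2.46), p. 233–234 [PDF 11–12] (2.57)–(2.59), Lemma 2.1 (2.60)–(2.63) (renders
`run/shared/lean/pub/pub-balaban/b2b-balaban-ref1/pages/1984-cmp96-propagators-rt-II/…-p002/p009/p011/p012-x2.png`, read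
as images this generation).  Unit `lit-balaban-p21` (Phase-2 proof seat p21 gen 10), HOME `run/shared/lean/pub/lit-balaban/`,
B6 fold owner r03, referee ref-4.

## WHAT IS PRINTED (p. 231, p. 233–234, verbatim up to notation)

p. 231: «Let us define 𝔅 = ⋃_{j=0}^{k} Λ_j, (2.45) and let us introduce the following distance in 𝔅: for y, y′ ∈ 𝔅
d(y, y′) = inf_Γ |Γ|, where Γ is a contour joining y and y′, built of admissible bonds, and |Γ| is the number of these
bonds. A part of Γ contained in B^j(Λ_j) consists of bonds of the lattice Λ_j. (2.46) … d(x, x′) = d(y, y′) if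
x ∈ B^j(y), x′ ∈ B^{j′}(y′).»  p. 224: «(L^jη)^{−1} dist(Ω_j^c, Ω_{j+1}) > RM, M is a size of big blocks and R is a big
positive integer fixed later. (2.2)»  p. 234: «Lemma 2.1. … sup_{y∈𝔅} Σ_{y′∈𝔅} e^{−αδ₀d(y,y′)} ≤ c₁(α), (2.61) …
Σ … ≤ c₁(α)^{n+1} e^{−(1−α)δ₀d(y,y′)}. (2.63)»

## WHAT THIS FILE CERTIFIES (kernel-checked; setting of `B6MultiLevelBoxOperator`)

For a nested family `D : Domains d ℓ M_h k P R` on the box `X = Π[0, L^k·L·M_h·P_μ)`: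
* §1 **`𝔅`** (`bset`: the blocks `B^j(y)`, `y ∈ Λ_j`, as pairs `(j, y)` = (level, label) of the box sites; `blkOf x` =
  the block of a site — print's `y^j(x)`; `corner`, the centre `cen`; a site lies in the block `(j, y)` iff its level-`j`
  label is `y`, `blkOf_eq_iff_blk`, the level being then `j` by (2.1), `Domains.lev_eq_of_blk_eq`);
* §2 **THE ADMISSIBLE BONDS AND (2.46)**: two distinct blocks are joined by a bond iff they TOUCH (contain box sites at
  sup-distance `≤ 1`) (`bond`); `d` = the graph distance; the `B6.Geometry` `geom D` (sites `𝔅`, scale = level, `d`,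
  `L`, `η = 1`) REALISED (`B6Geometry.Realizes`) by the contour system `csys D` (`realizes`); admissible contours exist
  (`connected`: along a lattice path consecutive sites have equal or touching blocks);
* §3 **THE WALK FORM OF (2.2)** `levelGap`: every chain of admissible bonds from a block of level `< i` to a block of
  level `> i` has at least `RM` bonds (`M = L·M_h`; `B6Geometry.LevelGap … (RM − 1)`) — from `Domains.sep` by a walk
  induction carrying a site of level `≥ i + 1` within `|Γ|·L^i` of the centre of the starting block (`walk_disp`);
  bond lengths `|cen u − cen v| ≤ L^{max}` (`dist_cen_le_of_adj`); per-level packing `#S ≤ (2r/L^j + 1)^{d+1}`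
  (`pack`);
* §4 **LEMMA 2.1 ON THE BOX** `lemma21_box`: (2.60) ∧ (2.61) ∧ (2.62) ∧ (2.63) for `geom D` with the constant
  `K261 N₀ (d+1) L 1 (αδ₀)` of `B6Ineq261LevelGap`, for every `N₀ ≥ 1` with `N₀ + 1 ≤ RM` and
  `e^{−αδ₀}·L^{2(d+1)/N₀} < 1` ((2.59)-shape) — `B6Ineq261LevelGap.lemma21_of_realizes_max` with §2–§3; plus the
  triangle inequality (2.54), `d(y, y) = 0`, `d ≥ 0`;
* §5 **`d` AGAINST THE STRAIGHT DISTANCE INSIDE A TWO-LEVEL REGION** (`dist_blkOf_le_line`, `dist_blkOf_le_box`): if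
  every site of the lattice box spanned by `x`, `x″` has level `≥ i`, then `d(y(x), y(x″)) ≤ (d+1)(|x − x″|_∞/L^i + 1)`
  — the comparison used on p. 232 to read the cube estimates (2.43)–(2.44) (decay in `(L^jη)^{−1}|x − x′|`) in the form
  (2.53) (decay in `d`).

## HONEST SCOPE

Levels `1 … k` on a Neumann box (print: `j = 0 … k` on the torus; `Λ₀`/`a₀ = +∞` not modelled, as in files 1–3); the
admissible bonds are modelled as «the two blocks touch» (print: «bonds of the lattice Λ_j» inside `B^j(Λ_j)`, the
bonds across `∂B^j(Λ_j)` being unspecified in print); the walk form of (2.2) comes with `RM − 1` for print's `RM`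
(our centres are half-integers); the (2.61)-constant is the `L`-dependent series constant of `B6Ineq261LevelGap` (print:
`c₁(α)`, refuted as typed — `B6Lemma21Counterexample` — and repaired on towers in the r03/p29 lineage).  Nothing is
inferred from the manuscript: every step is kernel-checked.
-/

namespace Literature.MathematicalPhysics.QuantumFieldTheory.Balaban1983to89.B6Geom246MultiLevelBox

open Finset
open Literature.MathematicalPhysics.QuantumFieldTheory.Balaban1983to89.B4ContourShift (supNorm abs_le_supNorm
  supNorm_nonneg exists_supNorm_eq)
open Literature.MathematicalPhysics.QuantumFieldTheory.Balaban1983to89.B4Reflection242 (boxDom mem_boxDom blk blk_mul)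
open Literature.MathematicalPhysics.QuantumFieldTheory.Balaban1983to89.B4Thm110ZeroBox (blk_blk)
open Literature.MathematicalPhysics.QuantumFieldTheory.Balaban1983to89.B6MultiLevelBoxOperator
open Literature.MathematicalPhysics.QuantumFieldTheory.Balaban1983to89.B6Geometry (ContourSystem Realizes LevelGap
  dist246 triangle254_of_realizes dist_self_of_realizes dist_nonneg_of_realizes)
open Literature.MathematicalPhysics.QuantumFieldTheory.Balaban1983to89.B6Ineq261LevelGap (K261 K261_nonneg
  lemma21_of_realizes_max levelGap_of_le)

noncomputable section

variable {d : ℕ}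

/-! ## §1 The blocks `𝔅` of the box -/

section Blocks

variable {ℓ Mh k R : ℕ} {P : Fin (d + 1) → ℕ} (D : Domains d ℓ Mh k P R)

/-- **`𝔅 = ⋃_j Λ_j` (2.45) ON THE BOX**: the blocks `B^j(y)` of the territories, as pairs `(j, y)` = (level, label of the
level-`j` block) of the box sites. [cite: Balaban1984PropagatorsII, (2.45) p.231, (2.1)–(2.4) p.224] -/
def bset : Finset (ℕ × (Fin (d + 1) → ℤ)) :=
  (boxDom (N0 ℓ Mh k P)).image fun x => (D.lev x, blk ((ℓ + 1) ^ D.lev x) x)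

/-- **`y^j(x)`**: the block of a site (`x ∈ B^j(y)`). [cite: Balaban1984PropagatorsII, p.231 («d(x, x′) = d(y, y′) if x ∈ B^j(y)»)] -/
def blkOf (x : ↥(boxDom (N0 ℓ Mh k P))) : ↥(bset D) :=
  ⟨(D.lev x.1, blk ((ℓ + 1) ^ D.lev x.1) x.1), Finset.mem_image_of_mem _ x.2⟩

/-- the data of `blkOf`. [cite: Balaban1984PropagatorsII, p.231, dictionary] -/
@[simp] theorem blkOf_val (x : ↥(boxDom (N0 ℓ Mh k P))) :
    (blkOf D x).1 = (D.lev x.1, blk ((ℓ + 1) ^ D.lev x.1) x.1) := rfl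

/-- every block has a site. [cite: Balaban1984PropagatorsII, (2.45) p.231] -/
theorem exists_blkOf_eq (s : ↥(bset D)) : ∃ x, blkOf D x = s := by
  obtain ⟨x, hx, hs⟩ := Finset.mem_image.1 s.2
  exact ⟨⟨x, hx⟩, Subtype.ext hs⟩

/-- the level of a block is in `[1, k]`. [cite: Balaban1984PropagatorsII, (2.3)–(2.4) p.224] -/
theorem scale_bounds (s : ↥(bset D)) : 1 ≤ s.1.1 ∧ s.1.1 ≤ k := by
  obtain ⟨x, rfl⟩ := exists_blkOf_eq D s
  exact ⟨D.one_le_lev _, D.lev_le _⟩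

/-- **A SITE LIES IN THE BLOCK `(j, y)` IFF ITS LEVEL-`j` LABEL IS `y`** — its level is then `j` (big blocks of level
`≥ 2` do not straddle `∂Ω_j`, `Domains.lev_eq_of_blk_eq`). [cite: Balaban1984PropagatorsII, (2.1) p.224] -/
theorem blkOf_eq_iff_blk {x : ↥(boxDom (N0 ℓ Mh k P))} {s : ↥(bset D)} :
    blkOf D x = s ↔ blk ((ℓ + 1) ^ s.1.1) x.1 = s.1.2 := by
  constructor
  · rintro rfl; rfl
  · intro h
    obtain ⟨x₀, rfl⟩ := exists_blkOf_eq D s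
    simp only [blkOf_val] at h
    have hlev : D.lev x.1 = D.lev x₀.1 := D.lev_eq_of_blk_eq x₀.2 x.2 h
    apply Subtype.ext
    simp only [blkOf_val, hlev, h]

/-- the level of a site of the block `(j, y)` is `j`. [cite: Balaban1984PropagatorsII, (2.3)–(2.4) p.224] -/
theorem lev_eq_of_blkOf_eq {x : ↥(boxDom (N0 ℓ Mh k P))} {s : ↥(bset D)} (h : blkOf D x = s) : D.lev x.1 = s.1.1 := by
  subst h; rfl

/-- the corner `L^j·y` of the block `(j, y)`. [cite: Balaban1984PropagatorsII, (2.1) p.224, dictionary] -/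
def corner (s : ↥(bset D)) : Fin (d + 1) → ℤ := fun μ => (((ℓ + 1) ^ s.1.1 : ℕ) : ℤ) * s.1.2 μ

/-- the label of the corner. [folklore] -/
private theorem blk_corner (s : ↥(bset D)) : blk ((ℓ + 1) ^ s.1.1) (corner D s) = s.1.2 :=
  blk_mul (Nat.one_le_pow _ _ (by omega)) _

/-- the coordinates of a site of the block `(j, y)`: `L^j·y_μ ≤ x_μ < L^j·y_μ + L^j`. [cite: Balaban1984PropagatorsII, (2.1) p.224, dictionary] -/
theorem coord_bounds {x : ↥(boxDom (N0 ℓ Mh k P))} {s : ↥(bset D)} (h : blkOf D x = s) (μ : Fin (d + 1)) :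
    (((ℓ + 1) ^ s.1.1 : ℕ) : ℤ) * s.1.2 μ ≤ x.1 μ ∧ x.1 μ < (((ℓ + 1) ^ s.1.1 : ℕ) : ℤ) * s.1.2 μ + (((ℓ + 1) ^ s.1.1 : ℕ) : ℤ) := by
  have hb := (blkOf_eq_iff_blk D).1 h
  have hn : (0 : ℤ) < (((ℓ + 1) ^ s.1.1 : ℕ) : ℤ) := by positivity
  have hμ : x.1 μ / (((ℓ + 1) ^ s.1.1 : ℕ) : ℤ) = s.1.2 μ := by rw [← hb]; rfl
  have h1 : (((ℓ + 1) ^ s.1.1 : ℕ) : ℤ) * (x.1 μ / (((ℓ + 1) ^ s.1.1 : ℕ) : ℤ)) + x.1 μ % (((ℓ + 1) ^ s.1.1 : ℕ) : ℤ)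
      = x.1 μ := Int.mul_ediv_add_emod _ _
  have h2 := Int.emod_nonneg (x.1 μ) hn.ne'
  have h3 := Int.emod_lt_of_pos (x.1 μ) hn
  rw [hμ] at h1
  constructor <;> linarith

/-- the corner of a block is a box site. [cite: Balaban1984PropagatorsII, (2.1) p.224, dictionary] -/
theorem corner_mem (s : ↥(bset D)) : corner D s ∈ boxDom (N0 ℓ Mh k P) := by
  obtain ⟨x₀, hx₀⟩ := exists_blkOf_eq D s
  have hx := mem_boxDom.1 x₀.2
  rw [mem_boxDom]
  intro μ
  obtain ⟨h1, h2⟩ := coord_bounds D hx₀ μ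
  have hn : (0 : ℤ) < (((ℓ + 1) ^ s.1.1 : ℕ) : ℤ) := by positivity
  refine ⟨?_, lt_of_le_of_lt h1 (hx μ).2⟩
  -- `0 ≤ x₀_μ < L^j(y_μ + 1)` forces `y_μ ≥ 0`
  have hy : 0 ≤ s.1.2 μ := by
    by_contra hneg
    push Not at hneg
    have : (((ℓ + 1) ^ s.1.1 : ℕ) : ℤ) * s.1.2 μ + (((ℓ + 1) ^ s.1.1 : ℕ) : ℤ) ≤ 0 := by nlinarith
    linarith [(hx μ).1]
  exact mul_nonneg hn.le hy

/-- the corner lies in its block. [cite: Balaban1984PropagatorsII, (2.1) p.224, dictionary] -/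
theorem blkOf_corner (s : ↥(bset D)) : blkOf D ⟨corner D s, corner_mem D s⟩ = s :=
  (blkOf_eq_iff_blk D).2 (blk_corner D s)

/-- the corner has the level of its block. [cite: Balaban1984PropagatorsII, (2.3)–(2.4) p.224] -/
theorem lev_corner (s : ↥(bset D)) : D.lev (corner D s) = s.1.1 := lev_eq_of_blkOf_eq D (blkOf_corner D s)

/-- a lattice point as a point of `ℝ^{d+1}` (sup metric; the ambient space of (2.48)/(2.57)). [cite: Balaban1984PropagatorsII, (2.48) p.232, dictionary] -/
def toR (x : Fin (d + 1) → ℤ) : Fin (d + 1) → ℝ := fun μ => (x μ : ℝ)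

/-- the sup distance of `B4ContourShift` is the sup metric of `ℝ^{d+1}`. [cite: Balaban1984PropagatorsII, (2.48) p.232, dictionary] -/
theorem supNorm_eq_dist (x y : Fin (d + 1) → ℤ) : supNorm (x - y) = dist (toR x) (toR y) := by
  refine le_antisymm ?_ ?_
  · obtain ⟨i, hi⟩ := exists_supNorm_eq (x - y)
    rw [hi, Pi.sub_apply, Int.cast_abs, Int.cast_sub]
    have := dist_le_pi_dist (toR x) (toR y) i
    rwa [Real.dist_eq] at this
  · refine (dist_pi_le_iff (supNorm_nonneg _)).2 fun i => ?_
    rw [Real.dist_eq]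
    have := abs_le_supNorm (x - y) i
    rwa [Pi.sub_apply, Int.cast_abs, Int.cast_sub] at this

/-- **THE CENTRE OF THE BLOCK** `(j, y)`: `L^j·y + (L^j − 1)/2` (its sites are within `(L^j − 1)/2` of it).
[cite: Balaban1984PropagatorsII, (2.1) p.224, dictionary] -/
def cen (s : ↥(bset D)) : Fin (d + 1) → ℝ :=
  fun μ => (((ℓ + 1) ^ s.1.1 : ℕ) : ℝ) * (s.1.2 μ : ℝ) + ((((ℓ + 1) ^ s.1.1 : ℕ) : ℝ) - 1) / 2

/-- a site of a block is within `(L^j − 1)/2` of its centre. [cite: Balaban1984PropagatorsII, (2.1) p.224, dictionary] -/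
theorem dist_toR_cen_le {x : ↥(boxDom (N0 ℓ Mh k P))} {s : ↥(bset D)} (h : blkOf D x = s) :
    dist (toR x.1) (cen D s) ≤ ((((ℓ + 1) ^ s.1.1 : ℕ) : ℝ) - 1) / 2 := by
  have hn1 : 1 ≤ (ℓ + 1) ^ s.1.1 := Nat.one_le_pow _ _ (by omega)
  have hn1' : (1 : ℝ) ≤ (((ℓ + 1) ^ s.1.1 : ℕ) : ℝ) := by exact_mod_cast hn1
  refine (dist_pi_le_iff (by linarith)).2 fun μ => ?_
  obtain ⟨h1, h2⟩ := coord_bounds D h μ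
  have h2' : x.1 μ ≤ (((ℓ + 1) ^ s.1.1 : ℕ) : ℤ) * s.1.2 μ + (((ℓ + 1) ^ s.1.1 : ℕ) : ℤ) - 1 := by omega
  have h1r : (((ℓ + 1) ^ s.1.1 : ℕ) : ℝ) * (s.1.2 μ : ℝ) ≤ (x.1 μ : ℝ) := by exact_mod_cast h1
  have h2r : (x.1 μ : ℝ) ≤ (((ℓ + 1) ^ s.1.1 : ℕ) : ℝ) * (s.1.2 μ : ℝ) + (((ℓ + 1) ^ s.1.1 : ℕ) : ℝ) - 1 := by
    exact_mod_cast h2'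
  rw [Real.dist_eq, abs_le]
  simp only [toR, cen]
  constructor <;> linarith

end Blocks

/-! ## §2 The admissible bonds, the distance (2.46) and the realised geometry -/

section Bonds

variable {ℓ Mh k R : ℕ} {P : Fin (d + 1) → ℕ} (D : Domains d ℓ Mh k P R)

/-- two blocks TOUCH: they contain box sites at sup-distance `≤ 1`. [cite: Balaban1984PropagatorsII, (2.46) p.231 («admissible bonds»), dictionary] -/
def Touch (s t : ↥(bset D)) : Prop :=
  ∃ x x' : ↥(boxDom (N0 ℓ Mh k P)), blkOf D x = s ∧ blkOf D x' = t ∧ supNorm (x.1 - x'.1) ≤ 1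

/-- **THE ADMISSIBLE BONDS**: distinct touching blocks. [cite: Balaban1984PropagatorsII, (2.46) p.231] -/
def bond : SimpleGraph ↥(bset D) := SimpleGraph.fromRel (Touch D)

variable {D}

/-- touching is symmetric. [cite: Balaban1984PropagatorsII, (2.46) p.231, dictionary] -/
theorem touch_symm {s t : ↥(bset D)} (h : Touch D s t) : Touch D t s := by
  obtain ⟨x, x', hx, hx', hd⟩ := h
  refine ⟨x', x, hx', hx, ?_⟩
  rw [show x'.1 - x.1 = -(x.1 - x'.1) by abel, B4TorusKernel.supNorm_neg]
  exact hd

/-- adjacency = distinct and touching. [cite: Balaban1984PropagatorsII, (2.46) p.231] -/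
theorem bond_adj {s t : ↥(bset D)} : (bond D).Adj s t ↔ s ≠ t ∧ Touch D s t := by
  rw [bond, SimpleGraph.fromRel_adj]
  constructor
  · rintro ⟨hne, h | h⟩
    · exact ⟨hne, h⟩
    · exact ⟨hne, touch_symm h⟩
  · rintro ⟨hne, h⟩
    exact ⟨hne, Or.inl h⟩

/-- neighbouring sites have equal or adjacent blocks. [cite: Balaban1984PropagatorsII, (2.46) p.231] -/
theorem reachable_of_near {x x' : ↥(boxDom (N0 ℓ Mh k P))} (h : supNorm (x.1 - x'.1) ≤ 1) :
    (bond D).Reachable (blkOf D x) (blkOf D x') := by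
  by_cases he : blkOf D x = blkOf D x'
  · rw [he]
  · exact SimpleGraph.Adj.reachable (bond_adj.2 ⟨he, x, x', rfl, rfl, h⟩)

variable (D)

/-- **THE GEOMETRY OF THE BOX** as a `B6.Geometry`: sites `𝔅`, scale = level, `d` = the graph distance (2.46) of the
admissible bonds, `L`, `η = 1` (the localisation vocabulary of `B6.Geometry` is not used: trivial fields).
[cite: Balaban1984PropagatorsII, (2.45)–(2.46) p.231] -/
def geom : B6.Geometry where
  Site := ↥(bset D)
  fin := inferInstance
  scale := fun s => s.1.1
  dist := fun s t => ((bond D).dist s t : ℝ)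
  k := k
  eta := 1
  L := (ℓ : ℝ) + 1
  R := 0
  M := 0
  Hyp21_22 := True
  Loc := Unit
  suppIn := fun _ _ => True
  supNorm := fun _ => 0
  l2Norm := fun _ => 0
  holder := fun _ _ => 0
  Cut := Unit
  cutIn := fun _ _ => True
  cutH := fun _ _ => 0
  cutSup := fun _ => 0

/-- the contour system realising `geom D`: lattice points = the blocks themselves, bonds = `bond D`. [cite: Balaban1984PropagatorsII, (2.46) p.231] -/
def csys : ContourSystem (geom D) := ⟨↥(bset D), bond D, id, fun s => s.1.1, fun _ => rfl⟩

/-- `geom D` is realised by `csys D` ((2.46) holds by definition). [cite: Balaban1984PropagatorsII, (2.46) p.231] -/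
theorem realizes : Realizes (geom D) (csys D) := fun _ _ => rfl

variable {D}

/-- one lattice step towards a target stays in the box and decreases the `ℓ¹` distance. [folklore] -/
private theorem step_exists {x x' : Fin (d + 1) → ℤ} (hx : x ∈ boxDom (N0 ℓ Mh k P)) (hx' : x' ∈ boxDom (N0 ℓ Mh k P))
    (hne : x ≠ x') :
    ∃ x₁ : Fin (d + 1) → ℤ, x₁ ∈ boxDom (N0 ℓ Mh k P) ∧ supNorm (x - x₁) ≤ 1 ∧
      ∑ μ, (x' μ - x₁ μ).natAbs + 1 = ∑ μ, (x' μ - x μ).natAbs := by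
  classical
  obtain ⟨μ, hμ⟩ : ∃ μ, x μ ≠ x' μ := by
    by_contra h
    push Not at h
    exact hne (funext h)
  set δ : ℤ := if x μ < x' μ then 1 else -1 with hδ
  refine ⟨Function.update x μ (x μ + δ), ?_, ?_, ?_⟩
  · rw [mem_boxDom] at hx hx' ⊢
    intro ν
    by_cases hν : ν = μ
    · subst hν
      rw [Function.update_self]
      have h1 := hx ν; have h2 := hx' ν
      rw [hδ]; split_ifs with hlt
      · constructor <;> omega
      · constructor <;> omega
    · rw [Function.update_of_ne hν]; exact hx ν
  · obtain ⟨i, hi⟩ := exists_supNorm_eq (x - Function.update x μ (x μ + δ))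
    rw [hi, Pi.sub_apply]
    by_cases hiμ : i = μ
    · subst hiμ
      rw [Function.update_self, hδ]
      split_ifs <;> simp
    · rw [Function.update_of_ne hiμ, sub_self]; simp
  · rw [← Finset.add_sum_erase _ _ (Finset.mem_univ μ), ← Finset.add_sum_erase _ (fun ν => (x' ν - x ν).natAbs)
      (Finset.mem_univ μ)]
    have hrest : ∑ ν ∈ Finset.univ.erase μ, (x' ν - Function.update x μ (x μ + δ) ν).natAbs
        = ∑ ν ∈ Finset.univ.erase μ, (x' ν - x ν).natAbs :=
      Finset.sum_congr rfl fun ν hν => by rw [Function.update_of_ne (Finset.ne_of_mem_erase hν)]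
    rw [hrest, Function.update_self]
    have hμ' : (x' μ - (x μ + δ)).natAbs + 1 = (x' μ - x μ).natAbs := by
      rw [hδ]; split_ifs with hlt <;> omega
    omega

/-- any two sites have mutually reachable blocks: a lattice path. [cite: Balaban1984PropagatorsII, (2.46) p.231 («a contour joining y and y′»)] -/
theorem reachable_blkOf (x x' : ↥(boxDom (N0 ℓ Mh k P))) : (bond D).Reachable (blkOf D x) (blkOf D x') := by
  suffices h : ∀ (n : ℕ) (x : ↥(boxDom (N0 ℓ Mh k P))), ∑ μ, (x'.1 μ - x.1 μ).natAbs = n →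
      (bond D).Reachable (blkOf D x) (blkOf D x') from h _ x rfl
  intro n
  induction n with
  | zero =>
      intro x hx
      have : x = x' := by
        apply Subtype.ext; funext μ
        have := (Finset.sum_eq_zero_iff.1 hx) μ (Finset.mem_univ μ)
        omega
      rw [this]
  | succ n ih =>
      intro x hx
      have hne : x.1 ≠ x'.1 := by
        intro he
        have : ∑ μ, (x'.1 μ - x.1 μ).natAbs = 0 := Finset.sum_eq_zero fun μ _ => by rw [he, sub_self]; rfl
        omega
      obtain ⟨x₁, hx₁, hd, hsum⟩ := step_exists x.2 x'.2 hne
      have h1 : (bond D).Reachable (blkOf D x) (blkOf D ⟨x₁, hx₁⟩) := reachable_of_near hd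
      exact h1.trans (ih ⟨x₁, hx₁⟩ (show ∑ μ, (x'.1 μ - x₁ μ).natAbs = n by omega))

/-- **ADMISSIBLE CONTOURS EXIST**: the bond graph is connected (box non-empty). [cite: Balaban1984PropagatorsII, (2.46) p.231] -/
theorem connected (hMh : 1 ≤ Mh) (hP : ∀ μ, 1 ≤ P μ) : (bond D).Connected := by
  have h0 : (fun _ => (0 : ℤ)) ∈ boxDom (N0 ℓ Mh k P) := by
    rw [mem_boxDom]; intro μ
    have : 1 ≤ N0 ℓ Mh k P μ := Nat.one_le_iff_ne_zero.2 (by unfold N0; have := hP μ; positivity)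
    constructor <;> [rfl; exact_mod_cast this]
  haveI : Nonempty ↥(bset D) := ⟨blkOf D ⟨_, h0⟩⟩
  refine ⟨fun s t => ?_⟩
  obtain ⟨x, rfl⟩ := exists_blkOf_eq D s
  obtain ⟨x', rfl⟩ := exists_blkOf_eq D t
  exact reachable_blkOf x x'

/-- `d(y, y′) ≤ 1` for equal or adjacent blocks, as a real number. [cite: Balaban1984PropagatorsII, (2.46) p.231] -/
theorem dist_le_one_of_near {x x' : ↥(boxDom (N0 ℓ Mh k P))} (h : supNorm (x.1 - x'.1) ≤ 1) :
    (bond D).dist (blkOf D x) (blkOf D x') ≤ 1 := by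
  by_cases he : blkOf D x = blkOf D x'
  · rw [he, SimpleGraph.dist_self]; exact zero_le_one
  · rw [SimpleGraph.dist_eq_one_iff_adj.2 (bond_adj.2 ⟨he, x, x', rfl, rfl, h⟩)]

end Bonds

/-! ## §3 The walk form of (2.2), the bond lengths and the packing -/

section LevelGapSec

variable {ℓ Mh k R : ℕ} {P : Fin (d + 1) → ℕ} {D : Domains d ℓ Mh k P R}

/-- powers of `L` are monotone. [folklore] -/
private theorem powL_mono {a b : ℕ} (h : a ≤ b) : (((ℓ + 1) ^ a : ℕ) : ℝ) ≤ (((ℓ + 1) ^ b : ℕ) : ℝ) := by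
  exact_mod_cast Nat.pow_le_pow_right (by omega) h

/-- **BOND LENGTHS**: the centres of two touching blocks are at most `L^{max level}` apart (sup metric).
[cite: Balaban1984PropagatorsII, (2.46) p.231 («bonds of the lattice Λ_j»)] -/
theorem dist_cen_le_of_touch {s t : ↥(bset D)} (h : Touch D s t) :
    dist (cen D s) (cen D t) ≤ (((ℓ + 1) ^ max s.1.1 t.1.1 : ℕ) : ℝ) := by
  obtain ⟨x, x', hx, hx', hd⟩ := h
  have h1 := dist_toR_cen_le D hx
  have h2 := dist_toR_cen_le D hx'
  rw [supNorm_eq_dist] at hd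
  have hs := powL_mono (ℓ := ℓ) (le_max_left s.1.1 t.1.1)
  have ht := powL_mono (ℓ := ℓ) (le_max_right s.1.1 t.1.1)
  calc dist (cen D s) (cen D t) ≤ dist (cen D s) (toR x.1) + dist (toR x.1) (toR x'.1) + dist (toR x'.1) (cen D t) :=
        dist_triangle4 _ _ _ _
    _ ≤ ((((ℓ + 1) ^ s.1.1 : ℕ) : ℝ) - 1) / 2 + 1 + ((((ℓ + 1) ^ t.1.1 : ℕ) : ℝ) - 1) / 2 := by
        rw [dist_comm] at h1; linarith
    _ ≤ (((ℓ + 1) ^ max s.1.1 t.1.1 : ℕ) : ℝ) := by linarith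

/-- bond lengths for adjacent blocks. [cite: Balaban1984PropagatorsII, (2.46) p.231] -/
theorem dist_cen_le_of_adj {s t : ↥(bset D)} (h : (bond D).Adj s t) :
    dist (cen D s) (cen D t) ≤ (((ℓ + 1) ^ max s.1.1 t.1.1 : ℕ) : ℝ) :=
  dist_cen_le_of_touch (bond_adj.1 h).2

/-- **THE WALK INDUCTION BEHIND (2.2) ⇒ (2.57)**: a chain of admissible bonds from a block `a` of level `≤ i` to a block
of level `> i` reaches a SITE of level `≥ i + 1` within `|Γ|·L^i` of the centre of `a` (every bond before the first
exit has both ends of level `≤ i`, length `≤ L^i`). [cite: Balaban1984PropagatorsII, (2.2) p.224, (2.57) p.233] -/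
theorem walk_disp {i : ℕ} :
    ∀ {a x : ↥(bset D)} (p : (bond D).Walk a x), a.1.1 ≤ i → i < x.1.1 →
      ∃ t : ↥(boxDom (N0 ℓ Mh k P)), i + 1 ≤ D.lev t.1 ∧
        dist (cen D a) (toR t.1) ≤ (p.length : ℝ) * (((ℓ + 1) ^ i : ℕ) : ℝ) := by
  intro a x p
  induction p with
  | nil => intro ha hx; omega
  | @cons a b e h p ih =>
    intro ha he
    have hLi : (1 : ℝ) ≤ (((ℓ + 1) ^ i : ℕ) : ℝ) := by exact_mod_cast Nat.one_le_pow _ _ (by omega)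
    have hlen : (((SimpleGraph.Walk.cons h p).length : ℕ) : ℝ) = (p.length : ℝ) + 1 := by
      rw [SimpleGraph.Walk.length_cons]; push_cast; ring
    obtain ⟨hne, x₁, x₂, hx₁, hx₂, hd⟩ := bond_adj.1 h
    have ha1 := powL_mono (ℓ := ℓ) ha
    by_cases hb : i < b.1.1
    · -- the first exit: `x₂ ∈ b` has level `> i`, and is within `(L^a − 1)/2 + 1 ≤ L^i` of the centre of `a`
      refine ⟨x₂, by rw [lev_eq_of_blkOf_eq D hx₂]; omega, ?_⟩
      rw [supNorm_eq_dist] at hd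
      have h1 := dist_toR_cen_le D hx₁
      rw [dist_comm] at h1
      calc dist (cen D a) (toR x₂.1) ≤ dist (cen D a) (toR x₁.1) + dist (toR x₁.1) (toR x₂.1) := dist_triangle _ _ _
        _ ≤ ((((ℓ + 1) ^ a.1.1 : ℕ) : ℝ) - 1) / 2 + 1 := by linarith
        _ ≤ (((ℓ + 1) ^ i : ℕ) : ℝ) := by linarith
        _ ≤ (((SimpleGraph.Walk.cons h p).length : ℕ) : ℝ) * (((ℓ + 1) ^ i : ℕ) : ℝ) := by
            rw [hlen]; nlinarith
    · push Not at hb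
      obtain ⟨t, ht, hdist⟩ := ih hb he
      refine ⟨t, ht, ?_⟩
      have hab : dist (cen D a) (cen D b) ≤ (((ℓ + 1) ^ i : ℕ) : ℝ) :=
        (dist_cen_le_of_adj h).trans (powL_mono (max_le ha hb))
      calc dist (cen D a) (toR t.1) ≤ dist (cen D a) (cen D b) + dist (cen D b) (toR t.1) := dist_triangle _ _ _
        _ ≤ (((ℓ + 1) ^ i : ℕ) : ℝ) + (p.length : ℝ) * (((ℓ + 1) ^ i : ℕ) : ℝ) := add_le_add hab hdist
        _ = (((SimpleGraph.Walk.cons h p).length : ℕ) : ℝ) * (((ℓ + 1) ^ i : ℕ) : ℝ) := by rw [hlen]; ring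

/-- **THE WALK FORM OF (2.2)**: every chain of admissible bonds from a block of level `< i` to a block of level `> i`
has at least `RM` bonds, `M = L·M_h` (`LevelGap … (RM − 1)`) — from `Domains.sep` («(L^jη)^{−1} dist(Ω_j^c, Ω_{j+1})
> RM») between the corner of the starting block and the site reached by `walk_disp`.
[cite: Balaban1984PropagatorsII, (2.2) p.224, (2.57) p.233] -/
theorem levelGap (D : Domains d ℓ Mh k P R) : LevelGap (bond D) (fun s => s.1.1) (R * ((ℓ + 1) * Mh) - 1) := by
  intro i u x hu hx p
  obtain ⟨t, ht, hdist⟩ := walk_disp p hu.le hx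
  -- `sep` between the corner of `u` (level `< i`) and `t` (level `≥ i + 1`)
  have hsep := D.sep i (corner D u) (corner_mem D u) t.1 t.2 (by rw [lev_corner]; exact hu) ht
  rw [supNorm_eq_dist] at hsep
  -- (elaborated without expected type, then restated: the ascribed elaboration times out in this context)
  have hc₀ := dist_toR_cen_le D (blkOf_corner D u)
  dsimp only at hc₀
  have hc : dist (toR (corner D u)) (cen D u) ≤ ((((ℓ + 1) ^ u.1.1 : ℕ) : ℝ) - 1) / 2 := hc₀
  have hui : (((ℓ + 1) ^ u.1.1 : ℕ) : ℝ) ≤ (((ℓ + 1) ^ i : ℕ) : ℝ) := powL_mono hu.le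
  have hLi : (0 : ℝ) < (((ℓ + 1) ^ i : ℕ) : ℝ) := by positivity
  have hbig : ((R * bigSide ℓ Mh i : ℕ) : ℝ) = ((R * ((ℓ + 1) * Mh) : ℕ) : ℝ) * (((ℓ + 1) ^ i : ℕ) : ℝ) := by
    rw [bigSide_eq]; push_cast; ring
  have htot : ((R * ((ℓ + 1) * Mh) : ℕ) : ℝ) * (((ℓ + 1) ^ i : ℕ) : ℝ)
      < ((p.length : ℝ) + 1 / 2) * (((ℓ + 1) ^ i : ℕ) : ℝ) := by
    calc ((R * ((ℓ + 1) * Mh) : ℕ) : ℝ) * (((ℓ + 1) ^ i : ℕ) : ℝ) = ((R * bigSide ℓ Mh i : ℕ) : ℝ) := hbig.symm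
      _ < dist (toR (corner D u)) (toR t.1) := hsep
      _ ≤ dist (toR (corner D u)) (cen D u) + dist (cen D u) (toR t.1) := dist_triangle _ _ _
      _ ≤ ((((ℓ + 1) ^ i : ℕ) : ℝ) - 1) / 2 + (p.length : ℝ) * (((ℓ + 1) ^ i : ℕ) : ℝ) := by linarith
      _ ≤ ((p.length : ℝ) + 1 / 2) * (((ℓ + 1) ^ i : ℕ) : ℝ) := by linarith
  have hlt : ((R * ((ℓ + 1) * Mh) : ℕ) : ℝ) < (p.length : ℝ) + 1 / 2 := lt_of_mul_lt_mul_right htot hLi.le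
  have hRM : R * ((ℓ + 1) * Mh) ≤ p.length := by
    have h' : ((R * ((ℓ + 1) * Mh) : ℕ) : ℝ) < ((p.length + 1 : ℕ) : ℝ) := by
      rw [Nat.cast_add, Nat.cast_one]; linarith
    have h'' : R * ((ℓ + 1) * Mh) < p.length + 1 := by exact_mod_cast h'
    exact Nat.lt_succ_iff.mp h''
  have hne : u ≠ x := fun h => by subst h; exact absurd (lt_trans hu hx) (lt_irrefl _)
  have h1 : 1 ≤ p.length := by
    rcases Nat.eq_zero_or_pos p.length with h0 | h0
    · exact absurd (SimpleGraph.Walk.eq_of_length_eq_zero h0) hne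
    · exact h0
  omega

/-- **PER-LEVEL PACKING**: a finite set of level-`j` blocks whose centres lie within sup-distance `r` of a point has at
most `(2r/L^j + 1)^{d+1}` elements (the centres run over a translate of the grid `L^j·ℤ^{d+1}`).
[cite: Balaban1984PropagatorsII, p.231 («the lattice Λ_j»), (2.58) p.233] -/
theorem pack (j : ℕ) (p : Fin (d + 1) → ℝ) (r : ℝ) (S : Finset ↥(bset D)) (hr : 0 ≤ r)
    (hS : ∀ s ∈ S, s.1.1 = j ∧ dist (cen D s) p ≤ r) :
    ((#S : ℕ) : ℝ) ≤ (2 * r / (((ℓ + 1) ^ j : ℕ) : ℝ) + 1) ^ (d + 1) := by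
  classical
  set sℓ : ℝ := (((ℓ + 1) ^ j : ℕ) : ℝ) with hsℓ
  have hsℓ0 : 0 < sℓ := by rw [hsℓ]; positivity
  set p' : Fin (d + 1) → ℝ := fun μ => p μ - (sℓ - 1) / 2 with hp'
  set lo : Fin (d + 1) → ℤ := fun μ => ⌈(p' μ - r) / sℓ⌉ with hlo
  set hi : Fin (d + 1) → ℤ := fun μ => ⌊(p' μ + r) / sℓ⌋ with hhi
  set B : Finset (Fin (d + 1) → ℤ) := Fintype.piFinset fun μ => Finset.Icc (lo μ) (hi μ) with hB
  have hinj : Set.InjOn (fun s : ↥(bset D) => s.1.2) S := by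
    intro s hs t ht hst
    apply Subtype.ext
    exact Prod.ext ((hS s hs).1.trans (hS t ht).1.symm) hst
  have hmaps : ∀ s ∈ S, (fun s : ↥(bset D) => s.1.2) s ∈ B := by
    intro s hs
    obtain ⟨hz, hdist⟩ := hS s hs
    rw [hB, Fintype.mem_piFinset]
    intro μ
    rw [Finset.mem_Icc]
    have hcoord : dist (cen D s μ) (p μ) ≤ r := (dist_le_pi_dist (cen D s) p μ).trans hdist
    rw [Real.dist_eq, abs_le] at hcoord
    have hpos : cen D s μ = sℓ * (s.1.2 μ : ℝ) + (sℓ - 1) / 2 := by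
      simp only [cen, hsℓ, hz]
    rw [hpos] at hcoord
    constructor
    · rw [hlo]
      refine Int.ceil_le.mpr ?_
      rw [div_le_iff₀ hsℓ0, hp']
      dsimp only
      linarith [hcoord.1]
    · rw [hhi]
      refine Int.le_floor.mpr ?_
      rw [le_div_iff₀ hsℓ0, hp']
      dsimp only
      linarith [hcoord.2]
  have hcardS : #S ≤ #B := Finset.card_le_card_of_injOn _ hmaps hinj
  have hcoordcard : ∀ μ, (#(Finset.Icc (lo μ) (hi μ)) : ℝ) ≤ 2 * r / sℓ + 1 := by
    intro μ
    rw [Int.card_Icc]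
    have h1 : ((hi μ + 1 - lo μ).toNat : ℝ) ≤ max ((hi μ : ℝ) + 1 - lo μ) 0 := by
      rcases le_or_gt 0 (hi μ + 1 - lo μ) with h | h
      · have e : ((hi μ + 1 - lo μ).toNat : ℝ) = (hi μ : ℝ) + 1 - lo μ := by
          exact_mod_cast Int.toNat_of_nonneg h
        rw [e]; exact le_max_left _ _
      · rw [Int.toNat_eq_zero.mpr h.le]; push_cast; exact le_max_right _ _
    refine h1.trans (max_le ?_ (by positivity))
    have hhi' : (hi μ : ℝ) ≤ (p' μ + r) / sℓ := Int.floor_le _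
    have hlo' : (p' μ - r) / sℓ ≤ (lo μ : ℝ) := Int.le_ceil _
    have : (p' μ + r) / sℓ - (p' μ - r) / sℓ = 2 * r / sℓ := by field_simp; ring
    linarith
  have hBcard : (#B : ℝ) ≤ (2 * r / sℓ + 1) ^ (d + 1) := by
    rw [hB, Fintype.card_piFinset]
    push_cast
    calc ∏ μ : Fin (d + 1), (#(Finset.Icc (lo μ) (hi μ)) : ℝ) ≤ ∏ _μ : Fin (d + 1), (2 * r / sℓ + 1) :=
          Finset.prod_le_prod (fun μ _ => Nat.cast_nonneg _) (fun μ _ => hcoordcard μ)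
      _ = (2 * r / sℓ + 1) ^ (d + 1) := by rw [Finset.prod_const, Finset.card_univ, Fintype.card_fin]
  calc ((#S : ℕ) : ℝ) ≤ #B := by exact_mod_cast hcardS
    _ ≤ (2 * r / sℓ + 1) ^ (d + 1) := hBcard

end LevelGapSec

/-! ## §4 Lemma 2.1 (2.60)–(2.63) on the box -/

section Lemma21

variable {ℓ Mh k R : ℕ} {P : Fin (d + 1) → ℕ} (D : Domains d ℓ Mh k P R)

/-- **[B6] LEMMA 2.1 FOR THE GENUINE NESTED FAMILY ON A BOX**: for every `N₀ ≥ 1` with `N₀ + 1 ≤ RM` (`M = L·M_h`),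
`δ₀ ≥ 0`, `0 ≤ α ≤ 1` and `e^{−αδ₀}·L^{2(d+1)/N₀} < 1` ((2.59): «RM sufficiently large»), the geometry `geom D` satisfies
(2.60), (2.61), (2.62), (2.63) with the constant `K261 N₀ (d+1) L 1 (αδ₀)` — `B6Ineq261LevelGap.lemma21_of_realizes_max`
on the realised system `csys D` with §2–§3. [cite: Balaban1984PropagatorsII, Lemma 2.1 (2.60)–(2.63) p.234, (2.59) p.233, (2.2) p.224] -/
theorem lemma21_box (hMh : 1 ≤ Mh) (hP : ∀ μ, 1 ≤ P μ) {N₀ : ℕ} (hN₀ : 0 < N₀)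
    (hRM : N₀ + 1 ≤ R * ((ℓ + 1) * Mh)) {δ₀ α : ℝ} (hδ₀ : 0 ≤ δ₀) (hα0 : 0 ≤ α) (hα1 : α ≤ 1)
    (hθ : Real.exp (-(α * δ₀)) * ((ℓ : ℝ) + 1) ^ ((2 * (d + 1 : ℕ) : ℝ) / N₀) < 1) :
    B6RandomWalk.Ineq260 (geom D) δ₀ α
      ∧ B6Lemma21Repaired.Ineq261With (K261 N₀ (d + 1) ((ℓ : ℝ) + 1) 1 (α * δ₀)) (geom D) δ₀ α
      ∧ B6Lemma21Repaired.Ineq262With (K261 N₀ (d + 1) ((ℓ : ℝ) + 1) 1 (α * δ₀)) (geom D) δ₀ α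
      ∧ B6Lemma21Repaired.Ineq263With (K261 N₀ (d + 1) ((ℓ : ℝ) + 1) 1 (α * δ₀)) (geom D) δ₀ α := by
  have hL1 : (1 : ℝ) ≤ (ℓ : ℝ) + 1 := by linarith [(Nat.cast_nonneg ℓ : (0 : ℝ) ≤ ℓ)]
  have hscl : ∀ n : ℕ, (((ℓ + 1) ^ n : ℕ) : ℝ) = ((ℓ : ℝ) + 1) ^ n := fun n => by push_cast; ring
  refine lemma21_of_realizes_max (g := geom D) (C := csys D) (pos := cen D)
    (ℓ := fun n => (((ℓ + 1) ^ n : ℕ) : ℝ)) (N := N₀) (Lr := (ℓ : ℝ) + 1) (A := 1) (dd := d + 1)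
    (realizes D) Function.injective_id (connected hMh hP)
    (levelGap_of_le (levelGap D) (by omega)) hN₀ (by simp [geom]) (fun u v h => dist_cen_le_of_adj h)
    (fun a b h => powL_mono h) (fun n => by positivity) (fun n => ?_) hL1 zero_le_one
    (fun j p r S hr hS => pack j p r S hr hS) hδ₀ hα0 hα1 hθ
  show (((ℓ + 1) ^ (n + 1) : ℕ) : ℝ) ≤ ((ℓ : ℝ) + 1) * (((ℓ + 1) ^ n : ℕ) : ℝ)
  rw [hscl, hscl, pow_succ]; ring_nf; exact le_rfl

/-- **(2.54), `d(y, y) = 0`, `d ≥ 0`** for `geom D` (the chain's side hypotheses). [cite: Balaban1984PropagatorsII, (2.54) p.232, (2.46) p.231] -/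
theorem triangle_refl_nonneg (hMh : 1 ≤ Mh) (hP : ∀ μ, 1 ≤ P μ) :
    B6RandomWalk.Triangle254 (geom D) ∧ (∀ y : (geom D).Site, (geom D).dist y y = 0)
      ∧ (∀ y y' : (geom D).Site, 0 ≤ (geom D).dist y y') :=
  ⟨triangle254_of_realizes (realizes D) (connected hMh hP), dist_self_of_realizes (realizes D),
    dist_nonneg_of_realizes (realizes D)⟩

end Lemma21

/-! ## §5 `d` against the straight distance inside a region of level `≥ i` -/

section Straight

variable {ℓ Mh k R : ℕ} {P : Fin (d + 1) → ℕ} {D : Domains d ℓ Mh k P R}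

/-- consecutive sites of level `≥ i` in a common level-`i` block have the same block of `𝔅`. [cite: Balaban1984PropagatorsII, (2.1) p.224] -/
theorem blkOf_eq_of_blk_i_eq {i : ℕ} {x x' : ↥(boxDom (N0 ℓ Mh k P))} (hi : i ≤ D.lev x.1)
    (h : blk ((ℓ + 1) ^ i) x'.1 = blk ((ℓ + 1) ^ i) x.1) : blkOf D x' = blkOf D x := by
  have hlev : D.lev x'.1 = D.lev x.1 := D.lev_eq_of_blk_eq_of_le x.2 x'.2 hi h
  apply Subtype.ext
  simp only [blkOf_val, hlev]
  obtain ⟨t, ht⟩ := Nat.exists_eq_add_of_le hi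
  rw [ht, pow_add, ← blk_blk, ← blk_blk, h]

/-- **ONE LATTICE DIRECTION**: moving `m` steps in direction `μ` through sites of level `≥ i`, the block of `𝔅` changes
at most `⌊(x_μ + m)/L^i⌋ − ⌊x_μ/L^i⌋` times. [cite: Balaban1984PropagatorsII, p.231–232 (d versus (L^jη)^{−1}|x − x′|), dictionary] -/
theorem dist_blkOf_le_line (hMh : 1 ≤ Mh) (hP : ∀ μ, 1 ≤ P μ) {i : ℕ} (μ : Fin (d + 1))
    (x : ↥(boxDom (N0 ℓ Mh k P))) :
    ∀ (m : ℕ) (hm : Function.update x.1 μ (x.1 μ + m) ∈ boxDom (N0 ℓ Mh k P)),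
      (∀ m' : ℕ, m' ≤ m → ∀ h' : Function.update x.1 μ (x.1 μ + m') ∈ boxDom (N0 ℓ Mh k P), i ≤ D.lev (Function.update x.1 μ (x.1 μ + m'))) →
      (((bond D).dist (blkOf D x) (blkOf D ⟨_, hm⟩) : ℕ) : ℤ)
        ≤ (x.1 μ + m) / (((ℓ + 1) ^ i : ℕ) : ℤ) - x.1 μ / (((ℓ + 1) ^ i : ℕ) : ℤ) := by
  have hconn := connected (D := D) hMh hP
  have hn : (0 : ℤ) < (((ℓ + 1) ^ i : ℕ) : ℤ) := by positivity
  intro m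
  induction m with
  | zero =>
      intro hm _
      have hx0 : (⟨Function.update x.1 μ (x.1 μ + ((0 : ℕ) : ℤ)), hm⟩ : ↥(boxDom (N0 ℓ Mh k P))) = x := by
        apply Subtype.ext; simp
      rw [hx0, SimpleGraph.dist_self]; simp
  | succ m ih =>
      intro hm hlev
      -- the previous site is in the box (between `x` and the current site)
      have hm' : Function.update x.1 μ (x.1 μ + m) ∈ boxDom (N0 ℓ Mh k P) := by
        rw [mem_boxDom] at hm ⊢
        intro ν
        by_cases hν : ν = μ
        · subst hν
          rw [Function.update_self]
          have h2 := hm ν; rw [Function.update_self] at h2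
          have h1 := (mem_boxDom.1 x.2) ν
          push_cast at h2 ⊢
          constructor <;> linarith
        · rw [Function.update_of_ne hν]; have := hm ν; rw [Function.update_of_ne hν] at this; exact this
      have hprev := ih hm' (fun m' hm'' h' => hlev m' (by omega) h')
      have hstep : supNorm (Function.update x.1 μ (x.1 μ + m) - Function.update x.1 μ (x.1 μ + ((m + 1 : ℕ) : ℤ))) ≤ 1 := by
        obtain ⟨j, hj⟩ := exists_supNorm_eq (Function.update x.1 μ (x.1 μ + m) - Function.update x.1 μ (x.1 μ + ((m + 1 : ℕ) : ℤ)))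
        rw [hj, Pi.sub_apply]
        by_cases hjμ : j = μ
        · subst hjμ; rw [Function.update_self, Function.update_self]; push_cast; simp
        · rw [Function.update_of_ne hjμ, Function.update_of_ne hjμ, sub_self]; simp
      have htri := hconn.dist_triangle (u := blkOf D x) (v := blkOf D ⟨_, hm'⟩) (w := blkOf D ⟨_, hm⟩)
      have hone := dist_le_one_of_near (D := D) (x := ⟨_, hm'⟩) (x' := ⟨_, hm⟩) hstep
      -- the floors `⌊(x_μ + m)/n⌋ ≤ ⌊(x_μ + m + 1)/n⌋`
      have hmono : (x.1 μ + m) / (((ℓ + 1) ^ i : ℕ) : ℤ) ≤ (x.1 μ + ((m + 1 : ℕ) : ℤ)) / (((ℓ + 1) ^ i : ℕ) : ℤ) :=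
        Int.ediv_le_ediv hn (by push_cast; linarith)
      by_cases heq : (x.1 μ + m) / (((ℓ + 1) ^ i : ℕ) : ℤ) = (x.1 μ + ((m + 1 : ℕ) : ℤ)) / (((ℓ + 1) ^ i : ℕ) : ℤ)
      · -- same level-`i` block: same block of `𝔅`
        have hblk : blk ((ℓ + 1) ^ i) (Function.update x.1 μ (x.1 μ + ((m + 1 : ℕ) : ℤ)))
            = blk ((ℓ + 1) ^ i) (Function.update x.1 μ (x.1 μ + m)) := by
          funext ν
          simp only [blk]
          by_cases hν : ν = μ
          · subst hν; rw [Function.update_self, Function.update_self, heq]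
          · rw [Function.update_of_ne hν, Function.update_of_ne hν]
        have hsame : blkOf D ⟨_, hm⟩ = blkOf D ⟨_, hm'⟩ :=
          blkOf_eq_of_blk_i_eq (x := ⟨_, hm'⟩) (x' := ⟨_, hm⟩) (hlev m (by omega) hm') hblk
        rw [hsame]
        exact hprev.trans (by rw [heq])
      · have hlt : (x.1 μ + m) / (((ℓ + 1) ^ i : ℕ) : ℤ) + 1 ≤ (x.1 μ + ((m + 1 : ℕ) : ℤ)) / (((ℓ + 1) ^ i : ℕ) : ℤ) := by
          omega
        have hone' : (((bond D).dist (blkOf D ⟨_, hm'⟩) (blkOf D ⟨_, hm⟩) : ℕ) : ℤ) ≤ 1 := by exact_mod_cast hone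
        have htri' : (((bond D).dist (blkOf D x) (blkOf D ⟨_, hm⟩) : ℕ) : ℤ)
            ≤ (((bond D).dist (blkOf D x) (blkOf D ⟨_, hm'⟩) : ℕ) : ℤ)
              + (((bond D).dist (blkOf D ⟨_, hm'⟩) (blkOf D ⟨_, hm⟩) : ℕ) : ℤ) := by exact_mod_cast htri
        linarith

/-- the floor count of one direction against the straight count: `⌊(a+m)/n⌋ − ⌊a/n⌋ < m/n + 1`. [folklore] -/
private theorem floor_diff_lt {a m n : ℤ} (hn : 0 < n) :
    ((((a + m) / n - a / n : ℤ)) : ℝ) < (m : ℝ) / n + 1 := by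
  have h1 : (a + m) / n * n ≤ a + m := Int.ediv_mul_le _ hn.ne'
  have h2 : a < (a / n + 1) * n := Int.lt_ediv_add_one_mul_self a hn
  have hn' : (0 : ℝ) < n := by exact_mod_cast hn
  have h3 : ((a + m) / n - a / n) * n < m + n := by
    rw [sub_mul]; rw [add_mul, one_mul] at h2; linarith
  have h3' : ((((a + m) / n - a / n : ℤ)) : ℝ) * n < m + n := by exact_mod_cast h3
  have e : (m : ℝ) / n + 1 = ((m : ℝ) + n) / n := by field_simp
  rw [e, lt_div_iff₀ hn']
  exact h3'

/-- the staircase from `x` to `x″`: the first `r` coordinates already those of `x″`. [folklore] -/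
private def stair (x x'' : Fin (d + 1) → ℤ) (r : ℕ) : Fin (d + 1) → ℤ :=
  fun μ => if (μ : ℕ) < r then x'' μ else x μ

/-- the staircase starts at `x`. [folklore] -/
private theorem stair_zero (x x'' : Fin (d + 1) → ℤ) : stair x x'' 0 = x :=
  funext fun μ => by simp [stair]

/-- the staircase ends at `x″`. [folklore] -/
private theorem stair_top (x x'' : Fin (d + 1) → ℤ) : stair x x'' (d + 1) = x'' :=
  funext fun μ => by simp [stair, μ.2]

/-- consecutive stairs agree off the coordinate being changed. [folklore] -/
private theorem stair_of_ne {x x'' : Fin (d + 1) → ℤ} {r : ℕ} {hr : r < d + 1} {μ : Fin (d + 1)}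
    (hμ : μ ≠ ⟨r, hr⟩) : stair x x'' (r + 1) μ = stair x x'' r μ := by
  have : (μ : ℕ) ≠ r := fun h => hμ (Fin.ext h)
  simp only [stair]
  split_ifs <;> first | rfl | omega

/-- the changed coordinate after the stair. [folklore] -/
private theorem stair_succ_self (x x'' : Fin (d + 1) → ℤ) {r : ℕ} (hr : r < d + 1) :
    stair x x'' (r + 1) ⟨r, hr⟩ = x'' ⟨r, hr⟩ := by
  simp [stair]

/-- the changed coordinate before the stair. [folklore] -/
private theorem stair_self (x x'' : Fin (d + 1) → ℤ) {r : ℕ} (hr : r < d + 1) :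
    stair x x'' r ⟨r, hr⟩ = x ⟨r, hr⟩ := by
  simp [stair]

/-- the staircase stays in the lattice box spanned by `x`, `x″`. [folklore] -/
private theorem stair_hull (x x'' : Fin (d + 1) → ℤ) (r : ℕ) (μ : Fin (d + 1)) :
    min (x μ) (x'' μ) ≤ stair x x'' r μ ∧ stair x x'' r μ ≤ max (x μ) (x'' μ) := by
  simp only [stair]
  split_ifs
  · exact ⟨min_le_right _ _, le_max_right _ _⟩
  · exact ⟨min_le_left _ _, le_max_left _ _⟩

/-- points of the lattice box spanned by two box sites are box sites. [folklore] -/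
private theorem mem_box_of_hull {x x'' z : Fin (d + 1) → ℤ} (hx : x ∈ boxDom (N0 ℓ Mh k P))
    (hx'' : x'' ∈ boxDom (N0 ℓ Mh k P)) (hz : ∀ μ, min (x μ) (x'' μ) ≤ z μ ∧ z μ ≤ max (x μ) (x'' μ)) :
    z ∈ boxDom (N0 ℓ Mh k P) := by
  rw [mem_boxDom] at hx hx'' ⊢
  intro μ
  obtain ⟨h1, h2⟩ := hz μ
  obtain ⟨a1, a2⟩ := hx μ
  obtain ⟨b1, b2⟩ := hx'' μ
  constructor
  · exact le_trans (le_min a1 b1) h1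
  · exact lt_of_le_of_lt h2 (max_lt a2 b2)

/-- **ONE STAIR**: the blocks of two box sites differing in one coordinate, all sites between them of level `≥ i`, are at
graph distance `≤ |x_μ − x″_μ|/L^i + 1`. [cite: Balaban1984PropagatorsII, p.231–232, dictionary] -/
theorem dist_blkOf_le_coord (hMh : 1 ≤ Mh) (hP : ∀ μ, 1 ≤ P μ) {i : ℕ} (μ : Fin (d + 1))
    (x z : ↥(boxDom (N0 ℓ Mh k P))) (hoff : ∀ ν, ν ≠ μ → z.1 ν = x.1 ν) (hxz : x.1 μ ≤ z.1 μ)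
    (hlev : ∀ w ∈ boxDom (N0 ℓ Mh k P), (∀ ν, ν ≠ μ → w ν = x.1 ν) → x.1 μ ≤ w μ → w μ ≤ z.1 μ → i ≤ D.lev w) :
    (((bond D).dist (blkOf D x) (blkOf D z) : ℕ) : ℝ)
      ≤ (((z.1 μ - x.1 μ : ℤ)) : ℝ) / (((ℓ + 1) ^ i : ℕ) : ℝ) + 1 := by
  obtain ⟨m, hm⟩ : ∃ m : ℕ, z.1 μ = x.1 μ + m := ⟨(z.1 μ - x.1 μ).toNat, by omega⟩
  have hzeq : z.1 = Function.update x.1 μ (x.1 μ + m) := by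
    funext ν
    by_cases hν : ν = μ
    · subst hν; rw [Function.update_self, hm]
    · rw [Function.update_of_ne hν, hoff ν hν]
  have hmem : Function.update x.1 μ (x.1 μ + m) ∈ boxDom (N0 ℓ Mh k P) := hzeq ▸ z.2
  have hz' : z = ⟨Function.update x.1 μ (x.1 μ + m), hmem⟩ := Subtype.ext hzeq
  have hline := dist_blkOf_le_line (D := D) hMh hP (i := i) μ x m hmem (fun m' hm' h' => by
    refine hlev _ h' (fun ν hν => by rw [Function.update_of_ne hν]) ?_ ?_
    · rw [Function.update_self]; linarith
    · rw [Function.update_self, hm]; exact_mod_cast (by omega : x.1 μ + m' ≤ x.1 μ + m))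
  rw [hz']
  have hn : (0 : ℤ) < (((ℓ + 1) ^ i : ℕ) : ℤ) := by positivity
  have hlt := floor_diff_lt (a := x.1 μ) (m := (m : ℤ)) hn
  have hline' : ((((bond D).dist (blkOf D x) (blkOf D ⟨_, hmem⟩) : ℕ) : ℤ) : ℝ)
      ≤ ((((x.1 μ + m) / (((ℓ + 1) ^ i : ℕ) : ℤ) - x.1 μ / (((ℓ + 1) ^ i : ℕ) : ℤ) : ℤ)) : ℝ) := by
    exact_mod_cast hline
  have e1 : ((((bond D).dist (blkOf D x) (blkOf D ⟨_, hmem⟩) : ℕ) : ℤ) : ℝ)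
      = (((bond D).dist (blkOf D x) (blkOf D ⟨_, hmem⟩) : ℕ) : ℝ) := by norm_cast
  have e2 : (Function.update x.1 μ (x.1 μ + ↑m) μ - x.1 μ : ℤ) = (m : ℤ) := by rw [Function.update_self]; ring
  rw [e2]
  rw [e1] at hline'
  have e3 : ((((ℓ + 1) ^ i : ℕ) : ℤ) : ℝ) = (((ℓ + 1) ^ i : ℕ) : ℝ) := by norm_cast
  rw [e3] at hlt
  push_cast at hlt hline' ⊢
  linarith

/-- **`d` AGAINST THE STRAIGHT DISTANCE IN A REGION OF LEVEL `≥ i`**: if every site of the lattice box spanned by two box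
sites `x`, `x″` has level `≥ i`, then `d(y(x), y(x″)) ≤ (d + 1)(|x − x″|_∞/L^i + 1)` — the staircase through the
box, one direction at a time (`dist_blkOf_le_coord`). [cite: Balaban1984PropagatorsII, p.231–232 («d(x, x′) = d(y, y′) if x ∈ B^j(y) …»), dictionary] -/
theorem dist_blkOf_le_box (hMh : 1 ≤ Mh) (hP : ∀ μ, 1 ≤ P μ) {i : ℕ} (x x'' : ↥(boxDom (N0 ℓ Mh k P)))
    (hlev : ∀ z ∈ boxDom (N0 ℓ Mh k P), (∀ μ, min (x.1 μ) (x''.1 μ) ≤ z μ ∧ z μ ≤ max (x.1 μ) (x''.1 μ)) →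
      i ≤ D.lev z) :
    (((bond D).dist (blkOf D x) (blkOf D x'') : ℕ) : ℝ)
      ≤ (d + 1) * (supNorm (x.1 - x''.1) / (((ℓ + 1) ^ i : ℕ) : ℝ) + 1) := by
  have hconn := connected (D := D) hMh hP
  have hLi : (0 : ℝ) < (((ℓ + 1) ^ i : ℕ) : ℝ) := by positivity
  -- the staircase points as box sites
  have hsmem : ∀ r, stair x.1 x''.1 r ∈ boxDom (N0 ℓ Mh k P) := fun r =>
    mem_box_of_hull x.2 x''.2 (stair_hull x.1 x''.1 r)
  set B : ℝ := supNorm (x.1 - x''.1) / (((ℓ + 1) ^ i : ℕ) : ℝ) + 1 with hB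
  -- one stair
  have hstep : ∀ (r : ℕ) (hr : r < d + 1),
      (((bond D).dist (blkOf D ⟨_, hsmem r⟩) (blkOf D ⟨_, hsmem (r + 1)⟩) : ℕ) : ℝ) ≤ B := by
    intro r hr
    have habs : (((|x.1 ⟨r, hr⟩ - x''.1 ⟨r, hr⟩| : ℤ)) : ℝ) ≤ supNorm (x.1 - x''.1) :=
      abs_le_supNorm (x.1 - x''.1) ⟨r, hr⟩
    -- all sites between the two stairs are in the hull, hence of level `≥ i`
    have hlev1 : ∀ (a b : ↥(boxDom (N0 ℓ Mh k P))), a.1 = stair x.1 x''.1 r ∨ a.1 = stair x.1 x''.1 (r + 1) →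
        b.1 = stair x.1 x''.1 r ∨ b.1 = stair x.1 x''.1 (r + 1) →
        ∀ w ∈ boxDom (N0 ℓ Mh k P), (∀ ν, ν ≠ (⟨r, hr⟩ : Fin (d + 1)) → w ν = a.1 ν) → a.1 ⟨r, hr⟩ ≤ w ⟨r, hr⟩ →
          w ⟨r, hr⟩ ≤ b.1 ⟨r, hr⟩ → i ≤ D.lev w := by
      intro a b ha hb w hw hoff h1 h2
      refine hlev w hw fun ν => ?_
      by_cases hν : ν = ⟨r, hr⟩
      · subst hν
        have hav : a.1 ⟨r, hr⟩ = x.1 ⟨r, hr⟩ ∨ a.1 ⟨r, hr⟩ = x''.1 ⟨r, hr⟩ := by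
          rcases ha with ha | ha
          · exact Or.inl (by rw [ha, stair_self])
          · exact Or.inr (by rw [ha, stair_succ_self])
        have hbv : b.1 ⟨r, hr⟩ = x.1 ⟨r, hr⟩ ∨ b.1 ⟨r, hr⟩ = x''.1 ⟨r, hr⟩ := by
          rcases hb with hb | hb
          · exact Or.inl (by rw [hb, stair_self])
          · exact Or.inr (by rw [hb, stair_succ_self])
        constructor
        · rcases hav with e | e <;> rw [e] at h1
          · exact le_trans (min_le_left _ _) h1
          · exact le_trans (min_le_right _ _) h1
        · rcases hbv with e | e <;> rw [e] at h2
          · exact le_trans h2 (le_max_left _ _)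
          · exact le_trans h2 (le_max_right _ _)
      · rw [hoff ν hν]
        rcases ha with ha | ha <;> rw [ha]
        · exact stair_hull x.1 x''.1 r ν
        · exact stair_hull x.1 x''.1 (r + 1) ν
    rcases le_total (x.1 ⟨r, hr⟩) (x''.1 ⟨r, hr⟩) with hle | hle
    · -- move up from stair r to stair (r+1)
      have h := dist_blkOf_le_coord (D := D) hMh hP (i := i) ⟨r, hr⟩ ⟨_, hsmem r⟩ ⟨_, hsmem (r + 1)⟩
        (fun ν hν => stair_of_ne hν) (by dsimp only; rw [stair_self, stair_succ_self]; exact hle)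
        (hlev1 _ _ (Or.inl rfl) (Or.inr rfl))
      refine h.trans ?_
      rw [hB]; dsimp only; rw [stair_self, stair_succ_self]
      have : (((x''.1 ⟨r, hr⟩ - x.1 ⟨r, hr⟩ : ℤ)) : ℝ) = (((|x.1 ⟨r, hr⟩ - x''.1 ⟨r, hr⟩| : ℤ)) : ℝ) := by
        rw [abs_sub_comm, abs_of_nonneg (by linarith)]
      rw [this]
      exact add_le_add (div_le_div_of_nonneg_right habs hLi.le) le_rfl
    · -- move up from stair (r+1) to stair r, then symmetry of `d`
      have h := dist_blkOf_le_coord (D := D) hMh hP (i := i) ⟨r, hr⟩ ⟨_, hsmem (r + 1)⟩ ⟨_, hsmem r⟩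
        (fun ν hν => (stair_of_ne hν).symm) (by dsimp only; rw [stair_self, stair_succ_self]; exact hle)
        (hlev1 _ _ (Or.inr rfl) (Or.inl rfl))
      rw [SimpleGraph.dist_comm] at h
      refine h.trans ?_
      rw [hB]; dsimp only; rw [stair_self, stair_succ_self]
      have : (((x.1 ⟨r, hr⟩ - x''.1 ⟨r, hr⟩ : ℤ)) : ℝ) = (((|x.1 ⟨r, hr⟩ - x''.1 ⟨r, hr⟩| : ℤ)) : ℝ) := by
        rw [abs_of_nonneg (by linarith)]
      rw [this]
      exact add_le_add (div_le_div_of_nonneg_right habs hLi.le) le_rfl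
  -- summing the stairs
  have hsum : ∀ r : ℕ, r ≤ d + 1 →
      (((bond D).dist (blkOf D ⟨_, hsmem 0⟩) (blkOf D ⟨_, hsmem r⟩) : ℕ) : ℝ) ≤ r * B := by
    intro r
    induction r with
    | zero => intro _; rw [SimpleGraph.dist_self]; simp
    | succ r ih =>
        intro hr
        have h1 := ih (by omega)
        have h2 := hstep r (by omega)
        have htri := hconn.dist_triangle (u := blkOf D ⟨_, hsmem 0⟩) (v := blkOf D ⟨_, hsmem r⟩)
          (w := blkOf D ⟨_, hsmem (r + 1)⟩)
        have htri' : (((bond D).dist (blkOf D ⟨_, hsmem 0⟩) (blkOf D ⟨_, hsmem (r + 1)⟩) : ℕ) : ℝ)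
            ≤ (((bond D).dist (blkOf D ⟨_, hsmem 0⟩) (blkOf D ⟨_, hsmem r⟩) : ℕ) : ℝ)
              + (((bond D).dist (blkOf D ⟨_, hsmem r⟩) (blkOf D ⟨_, hsmem (r + 1)⟩) : ℕ) : ℝ) := by
          exact_mod_cast htri
        push_cast
        linarith
  have hx0 : (⟨stair x.1 x''.1 0, hsmem 0⟩ : ↥(boxDom (N0 ℓ Mh k P))) = x := Subtype.ext (stair_zero x.1 x''.1)
  have hx1 : (⟨stair x.1 x''.1 (d + 1), hsmem (d + 1)⟩ : ↥(boxDom (N0 ℓ Mh k P))) = x'' :=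
    Subtype.ext (stair_top x.1 x''.1)
  have h := hsum (d + 1) le_rfl
  rw [hx0, hx1] at h
  push_cast at h
  rw [hB] at h
  exact h

end Straight

end

end Literature.MathematicalPhysics.QuantumFieldTheory.Balaban1983to89.B6Geom246MultiLevelBox
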